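import Mathlib
import Summits.NavierStokesRegularity.NavierStokesRegularity.Theorems.FilamentSkeletonRssStadiumFarPieceHolomorphic
import Summits.NavierStokesRegularity.NavierStokesRegularity.Theorems.FilamentSkeletonRssStadiumSegmentPiece
import Summits.NavierStokesRegularity.NavierStokesRegularity.Theorems.FilamentSkeletonRssStadiumChordPerturb
import Summits.NavierStokesRegularity.NavierStokesRegularity.Theorems.FilamentSkeletonRssStadiumPartnerPiece

/-!
# Route `FilamentSkeletonRss` · cruxes `SkeletonJ1L` (stmt-NavierStokesRegularity-23296, registered stub `stub_tangentSkeletonL` ≡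
# `TangentSkeletonNearStraightL`, stmt-23320) · line `child_tangent_analytic_strip_L` (b0b56c52900dd90a), stub `stub_stripPropagation` —
# brick for the freeze step of `rcore`: A FROZEN COMPACT REAL-AXIS PIECE OF THE ANCHOR'S TENT (the feet), FROM POSITIVITY AT THE ANCHOR

Real-source twin of `Theorems.StadiumFrozenSegmentNhds`.  The feet of the quarter-width tent are UNSHIFTED real sources `X σ` (right foot
`σ ≥ x₀ + hs/2`, certified pointwise in positivity form by `Theorems.StadiumCornerRightFoot.corner_right_foot_re_pos`; left foot beyond the long
plateau), possibly outside the parameter range of the stadium, so the kernel carries `X σ`, `X′ σ` and the real core `κ·A σ` themselves (the form of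
`Theorems.StadiumFarPieceHolomorphic.differentiableOn_farPiece` and of `Theorems.StadiumStripCore`).  For a COMPACT parameter interval `[a, b]` and an
anchor `z₀ ∈ S` with `0 < Re(Σᵢ (Fᵢ z₀ − Xᵢ σ)² + κ A σ)` for `σ ∈ [a, b]`:
* `anchor_real_margin` — a margin `m > 0` and a radius `δ > 0`, `B(z₀, δ) ⊆ S`, with `m ≤ Re(Σᵢ (Fᵢ z − Xᵢ σ)² + κ A σ)` for all `z ∈ B(z₀, δ)`,
  `σ ∈ [a, b]` (compactness of `{z₀} × [a, b]` in `ℂ × ℝ`, open superlevel set, uniform thickening);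
* `frozenRealPiece_nhds` — on that ball the frozen foot `z ↦ ∫_{σ∈[a,b]} ((Σᵢ (Fᵢ z − Xᵢ σ)² + κ A σ)^{3/2})⁻¹ • (X′ σ ⨯₃ (F z − X σ)) dσ` is
  holomorphic and bounded by `m^{-3/2}·2·R₁·(b − a)` with an explicit `R₁ = M·δ + sup_{[a,b]} ‖F z₀ − X σ‖` (`‖X′ σ‖ ≤ 1` complexified).
The unbounded tails of the feet keep their integrable Lorentzian majorants (`Theorems.StadiumOwnFarPiece` pattern); this file is the near, compact part
where only pointwise positivity is available.  Stadium `S = {|Im| < hs, |Re − cc| < L + hs}`, `F` holomorphic on `S` with `‖F′‖ ≤ M`, `X ∈ C¹` unit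
speed, `A` continuous; no numbers.
HONEST FRAMING: a brick for a plan about a HYPOTHETICAL filament skeleton on the NEGATIVE side of a MODEL route; the stub `stub_stripPropagation`
is NOT closed by this file, `TangentSkeletonNearStraightL` / `SkeletonJ1L` stay OPEN; nothing here bears on Navier–Stokes regularity or blow-up.
`--supports stmt-NavierStokesRegularity-23320` (≡ stub `stub_tangentSkeletonL` of 23296).
-/

set_option linter.dupNamespace false

noncomputable section

namespace Summit.NavierStokesRegularity.NavierStokesRegularity.Theorems.StadiumFrozenRealPiece

open Set Filter Topology Complex MeasureTheory Metric
open scoped Matrix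
open Summit.NavierStokesRegularity.NavierStokesRegularity.Theorems.StadiumFarPieceHolomorphic
open Summit.NavierStokesRegularity.NavierStokesRegularity.Theorems.StadiumSegmentPiece
open Summit.NavierStokesRegularity.NavierStokesRegularity.Theorems.StadiumChordPerturb
open Summit.NavierStokesRegularity.NavierStokesRegularity.Theorems.StadiumPartnerPiece

/-- **Margin of a compact real foot near the anchor.**  `F` holomorphic on the stadium `S`, `X` continuous, `A` continuous, anchor `z₀ ∈ S`,
pointwise positivity `0 < Re(Σᵢ (Fᵢ z₀ − Xᵢ σ)² + κ A σ)` for `σ ∈ [a, b]`.  Then some `m, δ > 0` with `B(z₀, δ) ⊆ S` and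
`m ≤ Re(Σᵢ (Fᵢ z − Xᵢ σ)² + κ A σ)` for all `z ∈ B(z₀, δ)`, `σ ∈ [a, b]`. [folklore] -/
theorem anchor_real_margin {hs L cc : ℝ} {F : ℂ → (Fin 3 → ℂ)}
    (hF : DifferentiableOn ℂ F {z : ℂ | |z.im| < hs ∧ |z.re - cc| < L + hs})
    {X : ℝ → EuclideanSpace ℝ (Fin 3)} (hX : Continuous X) {A : ℝ → ℝ} (hA : Continuous A)
    {z₀ : ℂ} (hz₀ : z₀ ∈ {z : ℂ | |z.im| < hs ∧ |z.re - cc| < L + hs}) {a b : ℝ} (hab : a ≤ b) {κ : ℝ}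
    (hpos : ∀ σ ∈ Icc a b, 0 < ((∑ i, (F z₀ i - ((X σ i : ℝ) : ℂ)) ^ 2) + ((κ * A σ : ℝ) : ℂ)).re) :
    ∃ m δ : ℝ, 0 < m ∧ 0 < δ ∧ ball z₀ δ ⊆ {z : ℂ | |z.im| < hs ∧ |z.re - cc| < L + hs} ∧
      ∀ z ∈ ball z₀ δ, ∀ σ ∈ Icc a b, m ≤ ((∑ i, (F z i - ((X σ i : ℝ) : ℂ)) ^ 2) + ((κ * A σ : ℝ) : ℂ)).re := by
  set S : Set ℂ := {z : ℂ | |z.im| < hs ∧ |z.re - cc| < L + hs} with hS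
  have hSo : IsOpen S := isOpen_stadium hs (L + hs) cc
  -- continuity of the real source data
  have hofLp : Continuous (@WithLp.ofLp 2 (Fin 3 → ℝ)) := PiLp.continuous_ofLp 2 (fun _ : Fin 3 => ℝ)
  have hXo : Continuous fun σ => WithLp.ofLp (X σ) := hofLp.comp hX
  have hXi : ∀ i, Continuous fun σ => ((X σ i : ℝ) : ℂ) := fun i =>
    Complex.continuous_ofReal.comp ((continuous_apply i).comp hXo)
  have hAi : Continuous fun σ => ((κ * A σ : ℝ) : ℂ) := Complex.continuous_ofReal.comp (continuous_const.mul hA)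
  -- the joint function `Ψ(z, σ)` on `S × ℝ`
  set Ψ : ℂ × ℝ → ℝ := fun x => ((∑ i, (F x.1 i - ((X x.2 i : ℝ) : ℂ)) ^ 2) + ((κ * A x.2 : ℝ) : ℂ)).re with hΨ
  have hΨc : ContinuousOn Ψ (S ×ˢ univ) := by
    have h1 : ContinuousOn (fun x : ℂ × ℝ => F x.1) (S ×ˢ univ) :=
      hF.continuousOn.comp continuous_fst.continuousOn (fun x hx => hx.1)
    have h4 : ContinuousOn (fun x : ℂ × ℝ => ∑ i, (F x.1 i - ((X x.2 i : ℝ) : ℂ)) ^ 2) (S ×ˢ univ) := by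
      refine continuousOn_finsetSum _ fun i _ => ?_
      exact (((continuous_apply i).comp_continuousOn h1).sub ((hXi i).comp continuous_snd).continuousOn).pow 2
    exact Complex.continuous_re.comp_continuousOn (h4.add (hAi.comp continuous_snd).continuousOn)
  -- the compact anchor set `{z₀} × [a, b]`
  set Kset : Set (ℂ × ℝ) := (fun σ : ℝ => (z₀, σ)) '' Icc a b with hKset
  have hKc : IsCompact Kset := isCompact_Icc.image (continuous_const.prodMk continuous_id)
  have hKS : Kset ⊆ S ×ˢ univ := by
    rintro _ ⟨σ, -, rfl⟩
    exact ⟨hz₀, mem_univ _⟩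
  have hKne : Kset.Nonempty := ⟨(z₀, a), ⟨a, ⟨le_rfl, hab⟩, rfl⟩⟩
  obtain ⟨x₀, hx₀K, hx₀min⟩ := hKc.exists_isMinOn hKne (hΨc.mono hKS)
  obtain ⟨σ₀, hσ₀, hx₀eq⟩ := hx₀K
  have hm0 : 0 < Ψ x₀ := by
    rw [← hx₀eq]
    exact hpos σ₀ hσ₀
  set U : Set (ℂ × ℝ) := (S ×ˢ univ) ∩ Ψ ⁻¹' (Ioi (Ψ x₀ / 2)) with hU
  have hUo : IsOpen U := hΨc.isOpen_inter_preimage (hSo.prod isOpen_univ) isOpen_Ioi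
  have hKU : Kset ⊆ U := by
    intro x hx
    refine ⟨hKS hx, ?_⟩
    show Ψ x₀ / 2 < Ψ x
    have := (isMinOn_iff.mp hx₀min) x hx
    linarith
  obtain ⟨δ, hδ, hthick⟩ := hKc.exists_thickening_subset_open hUo hKU
  refine ⟨Ψ x₀ / 2, δ, half_pos hm0, hδ, ?_, ?_⟩
  · intro z hz
    have hmem : (z, a) ∈ thickening δ Kset := by
      rw [mem_thickening_iff]
      refine ⟨(z₀, a), ⟨a, ⟨le_rfl, hab⟩, rfl⟩, ?_⟩
      rw [Prod.dist_eq, dist_self]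
      exact max_lt (mem_ball.mp hz) hδ
    exact (hthick hmem).1.1
  · intro z hz σ hσ
    have hmem : (z, σ) ∈ thickening δ Kset := by
      rw [mem_thickening_iff]
      refine ⟨(z₀, σ), ⟨σ, hσ, rfl⟩, ?_⟩
      rw [Prod.dist_eq, dist_self]
      exact max_lt (mem_ball.mp hz) hδ
    exact le_of_lt (hthick hmem).2

/-- **A frozen compact real foot of the anchor's tent, on a ball of targets.**  Stadium `S`; `F` holomorphic on `S` with `‖F′‖ ≤ M`; `X ∈ C¹`
unit speed; `A` continuous; anchor `z₀ ∈ S`; pointwise positivity at the anchor on the compact parameter interval `[a, b]`.  Then for some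
`μ, δ > 0` and `R₁ ≥ 0` with `B(z₀, δ) ⊆ S`: the margin `μ` holds on `B(z₀, δ) × [a, b]`, `‖F z − X σ‖ ≤ R₁` there (sup norm of the complexified
chord), the frozen foot `z ↦ ∫_{σ∈[a,b]} ((Σᵢ (Fᵢ z − Xᵢ σ)² + κ A σ)^{3/2})⁻¹ • (X′ σ ⨯₃ (F z − X σ)) dσ` is holomorphic on `B(z₀, δ)`
(`Theorems.StadiumFarPieceHolomorphic.differentiableOn_farPiece`) and bounded there by `μ^{-3/2}·(2·1·R₁)·(b − a)`. [folklore] -/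
theorem frozenRealPiece_nhds {hs L cc M : ℝ} {F : ℂ → (Fin 3 → ℂ)}
    (hF : DifferentiableOn ℂ F {z : ℂ | |z.im| < hs ∧ |z.re - cc| < L + hs})
    (hM : ∀ z ∈ {z : ℂ | |z.im| < hs ∧ |z.re - cc| < L + hs}, ‖deriv F z‖ ≤ M) (hM0 : 0 ≤ M)
    {X : ℝ → EuclideanSpace ℝ (Fin 3)} (hX : ContDiff ℝ 1 X) (hXu : ∀ τ, ‖deriv X τ‖ = 1)
    {A : ℝ → ℝ} (hA : Continuous A)
    {z₀ : ℂ} (hz₀ : z₀ ∈ {z : ℂ | |z.im| < hs ∧ |z.re - cc| < L + hs}) {a b : ℝ} (hab : a ≤ b) {κ : ℝ}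
    (hpos : ∀ σ ∈ Icc a b, 0 < ((∑ i, (F z₀ i - ((X σ i : ℝ) : ℂ)) ^ 2) + ((κ * A σ : ℝ) : ℂ)).re) :
    ∃ μ δ R₁ : ℝ, 0 < μ ∧ 0 < δ ∧ 0 ≤ R₁ ∧ ball z₀ δ ⊆ {z : ℂ | |z.im| < hs ∧ |z.re - cc| < L + hs} ∧
      (∀ z ∈ ball z₀ δ, ∀ σ ∈ Icc a b, μ ≤ ((∑ i, (F z i - ((X σ i : ℝ) : ℂ)) ^ 2) + ((κ * A σ : ℝ) : ℂ)).re) ∧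
      (∀ z ∈ ball z₀ δ, ∀ σ ∈ Icc a b, ‖(fun i => F z i - ((X σ i : ℝ) : ℂ))‖ ≤ R₁) ∧
      DifferentiableOn ℂ (fun z => ∫ σ in Icc a b,
        (((∑ i, (F z i - ((X σ i : ℝ) : ℂ)) ^ 2) + ((κ * A σ : ℝ) : ℂ)) ^ ((3:ℂ) / 2))⁻¹ •
          ((fun i => ((deriv X σ i : ℝ) : ℂ)) ⨯₃ (fun i => F z i - ((X σ i : ℝ) : ℂ)))) (ball z₀ δ) ∧
      (∀ z ∈ ball z₀ δ, ‖∫ σ in Icc a b,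
        (((∑ i, (F z i - ((X σ i : ℝ) : ℂ)) ^ 2) + ((κ * A σ : ℝ) : ℂ)) ^ ((3:ℂ) / 2))⁻¹ •
          ((fun i => ((deriv X σ i : ℝ) : ℂ)) ⨯₃ (fun i => F z i - ((X σ i : ℝ) : ℂ)))‖ ≤
        μ ^ (-(3/2 : ℝ)) * (2 * 1 * R₁) * (b - a)) := by
  set S : Set ℂ := {z : ℂ | |z.im| < hs ∧ |z.re - cc| < L + hs} with hS
  obtain ⟨m, δ, hm, hδ, hballS, hmargin⟩ := anchor_real_margin hF hX.continuous hA hz₀ hab hpos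
  -- continuity of the real source data
  have hofLp : Continuous (@WithLp.ofLp 2 (Fin 3 → ℝ)) := PiLp.continuous_ofLp 2 (fun _ : Fin 3 => ℝ)
  have hXo : Continuous fun σ => WithLp.ofLp (X σ) := hofLp.comp hX.continuous
  have hXi : ∀ i, Continuous fun σ => ((X σ i : ℝ) : ℂ) := fun i =>
    Complex.continuous_ofReal.comp ((continuous_apply i).comp hXo)
  -- a bound for the chord at the anchor over the compact foot, then on the ball by the Lipschitz bound
  have hPc : Continuous fun σ => (fun i => F z₀ i - ((X σ i : ℝ) : ℂ)) :=
    continuous_pi fun i => continuous_const.sub (hXi i)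
  obtain ⟨R₀, hR₀⟩ := (isCompact_Icc : IsCompact (Icc a b)).exists_bound_of_continuousOn (continuous_norm.comp hPc).continuousOn
  have hR₀' : ∀ σ ∈ Icc a b, ‖(fun i => F z₀ i - ((X σ i : ℝ) : ℂ))‖ ≤ R₀ := fun σ hσ => by
    have h := hR₀ σ hσ
    simp only [Function.comp_apply, Real.norm_eq_abs, abs_norm] at h
    exact h
  have hR₀nn : 0 ≤ R₀ := (norm_nonneg _).trans (hR₀' a ⟨le_rfl, hab⟩)
  set R₁ : ℝ := M * δ + R₀ with hR₁
  have hR₁nn : 0 ≤ R₁ := by positivity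
  have hR : ∀ z ∈ ball z₀ δ, ∀ σ ∈ Icc a b, ‖(fun i => F z i - ((X σ i : ℝ) : ℂ))‖ ≤ R₁ := by
    intro z hz σ hσ
    have hzS : z ∈ S := hballS hz
    have hzz₀ : ‖z - z₀‖ < δ := by rwa [mem_ball, dist_eq_norm] at hz
    have hlip := (component_lipschitz hF hM hzS hz₀).1
    have e : (fun i => F z i - ((X σ i : ℝ) : ℂ)) = (F z - F z₀) + (fun i => F z₀ i - ((X σ i : ℝ) : ℂ)) := by
      funext i; simp
    rw [e]
    calc ‖(F z - F z₀) + (fun i => F z₀ i - ((X σ i : ℝ) : ℂ))‖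
        ≤ ‖F z - F z₀‖ + ‖(fun i => F z₀ i - ((X σ i : ℝ) : ℂ))‖ := norm_add_le _ _
      _ ≤ M * ‖z - z₀‖ + R₀ := add_le_add hlip (hR₀' σ hσ)
      _ ≤ M * δ + R₀ := by nlinarith [hzz₀.le]
  -- the tangent has complexified sup norm ≤ 1
  have hD : ∀ σ, ‖(fun i => ((deriv X σ i : ℝ) : ℂ))‖ ≤ 1 := fun σ => by
    refine (pi_norm_le_iff_of_nonneg zero_le_one).2 fun i => ?_
    rw [Complex.norm_real]
    exact (PiLp.norm_apply_le (deriv X σ) i).trans (hXu σ).le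
  -- the kernel bound on the ball
  have hdom : ∀ z ∈ ball z₀ δ, ∀ σ ∈ Icc a b,
      ‖(((∑ i, (F z i - ((X σ i : ℝ) : ℂ)) ^ 2) + ((κ * A σ : ℝ) : ℂ)) ^ ((3:ℂ) / 2))⁻¹ •
        ((fun i => ((deriv X σ i : ℝ) : ℂ)) ⨯₃ (fun i => F z i - ((X σ i : ℝ) : ℂ)))‖ ≤ m ^ (-(3/2 : ℝ)) * (2 * 1 * R₁) :=
    fun z hz σ hσ => segment_kernel_norm_le hm (hmargin z hz σ hσ) (hD σ) (hR z hz σ hσ)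
  have hpos' : ∀ z ∈ ball z₀ δ, ∀ σ ∈ Icc a b,
      0 < ((∑ i, (F z i - ((X σ i : ℝ) : ℂ)) ^ 2) + ((κ * A σ : ℝ) : ℂ)).re :=
    fun z hz σ hσ => lt_of_lt_of_le hm (hmargin z hz σ hσ)
  refine ⟨m, δ, R₁, hm, hδ, hR₁nn, hballS, hmargin, hR, ?_, ?_⟩
  · exact differentiableOn_farPiece isOpen_ball (hF.mono hballS) hX hA measurableSet_Icc hpos'
      (bound := fun _ => m ^ (-(3/2 : ℝ)) * (2 * 1 * R₁)) (by exact integrableOn_const (by simp)) hdom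
  · intro z hz
    have h := norm_setIntegral_le_of_norm_le_const (μ := volume) (s := Icc a b) (by simp) (hdom z hz)
    rw [measureReal_def, Real.volume_Icc, ENNReal.toReal_ofReal (by linarith)] at h
    exact h

end Summit.NavierStokesRegularity.NavierStokesRegularity.Theorems.StadiumFrozenRealPiece

end
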